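import Summits.NavierStokesRegularity.TurbBounds.SpectralFormFreeSlip
import Summits.NavierStokesRegularity.TurbBounds.FSU1.Mode.M01Calculus

/-!
# FS-U1″ mode lemma — Young (`TurbBounds/FSU1/Mode/M04Young.lean`)

FS-PROOF-DRAFT §3.2: the Young split `fsModeForm ≥ E_u` of the cross term.

Cell-made mathematics of FS-PROOF-DRAFT §3 (pub-turb-sos), kernel-checked; generated from the design compose file
`StageF_compose.check.lean` (96c4b9bf…) by `build_mode_split.py`.  HONEST FRAMING: rigorous bounds for the stated PDE and boundary conditions; no claim about physical turbulence beyond the bound.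
-/

open Real intervalIntegral MeasureTheory Set

namespace Summit.NavierStokesRegularity.TurbBounds.FSU1.Mode

open Summit.NavierStokesRegularity.TurbBounds.SpectralFormFreeSlip

/-! ## Regularity from `FreeSlipPair` -/

/-! ## The Young split -/

/-- The Young majorant density `u k² θ² + (a²/(4uRa)) Ω²`. -/
noncomputable def youngDensity (u Ra a k : ℝ) (v θ : ℝ → ℝ) (z : ℝ) : ℝ :=
  u * k ^ 2 * θ z ^ 2 + a ^ 2 / (4 * u * Ra) * vort k v z ^ 2

/-- `E_u := ∫₀¹ (fsIntegrand − youngDensity u)` (FS-PROOF-DRAFT §3.2, with the integrand kept in the tree's shape). -/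
noncomputable def Eu (u Ra a b : ℝ) (τp : ℝ → ℝ) (k : ℝ) (v θ : ℝ → ℝ) : ℝ :=
  ∫ z in (0 : ℝ)..1, (fsIntegrand Ra a b τp k v θ z - youngDensity u Ra a k v θ z)

/-- Pointwise Young: `(a k/√Ra)|x y| ≤ u k² y² + (a²/(4uRa)) x²` (no sign condition on `a`, `k` is needed). -/
theorem pointwise_young {u Ra : ℝ} (a k x y : ℝ) (hu : 0 < u) (hRa : 0 < Ra) :
    a * k / Real.sqrt Ra * |x * y| ≤ u * k ^ 2 * y ^ 2 + a ^ 2 / (4 * u * Ra) * x ^ 2 := by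
  obtain ⟨r, hr0, hrRa⟩ : ∃ r : ℝ, 0 < r ∧ r ^ 2 = Ra := ⟨Real.sqrt Ra, Real.sqrt_pos.mpr hRa, Real.sq_sqrt hRa.le⟩
  have hsq : Real.sqrt Ra = r := by rw [← hrRa, Real.sqrt_sq hr0.le]
  rw [hsq]
  subst hrRa
  rw [abs_mul, div_mul_eq_mul_div, div_le_iff₀ hr0]
  have e : (u * k ^ 2 * y ^ 2 + a ^ 2 / (4 * u * r ^ 2) * x ^ 2) * r
      = (4 * u ^ 2 * r ^ 2 * k ^ 2 * y ^ 2 + a ^ 2 * x ^ 2) * r / (4 * u * r ^ 2) := by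
    field_simp
  rw [e, le_div_iff₀ (by positivity)]
  have key : 4 * u * r * k * a * (|x| * |y|) ≤ 4 * u ^ 2 * r ^ 2 * k ^ 2 * y ^ 2 + a ^ 2 * x ^ 2 := by
    rw [← sq_abs x, ← sq_abs y]
    nlinarith [sq_nonneg (2 * u * r * k * |y| - a * |x|)]
  nlinarith [mul_le_mul_of_nonneg_right key hr0.le, hr0, hu]

/-- `fsCross ≤ ∫₀¹ youngDensity u` on the free-slip class. -/
theorem fsCross_le_integral_young {u Ra a k : ℝ} {v θ : ℝ → ℝ} (hp : FreeSlipPair v θ)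
    (hu : 0 < u) (hRa : 0 < Ra) (hk : 0 ≤ k) (ha : 0 ≤ a) :
    fsCross Ra a k v θ ≤ ∫ z in (0 : ℝ)..1, youngDensity u Ra a k v θ z := by
  have hΩ : Continuous (vort k v) := continuous_vort hp.hv k
  have hθ : Continuous θ := hp.hθ.continuous
  have h1 : |∫ z in (0 : ℝ)..1, vort k v z * θ z| ≤ ∫ z in (0 : ℝ)..1, |vort k v z * θ z| :=
    abs_integral_le_integral_abs zero_le_one
  have hc0 : 0 ≤ a * k / Real.sqrt Ra := by positivity
  have hiL : IntervalIntegrable (fun z => a * k / Real.sqrt Ra * |vort k v z * θ z|) volume 0 1 :=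
    (continuous_const.mul (hΩ.mul hθ).abs).intervalIntegrable _ _
  have hiR : IntervalIntegrable (youngDensity u Ra a k v θ) volume 0 1 := by
    unfold youngDensity
    exact ((continuous_const.mul (hθ.pow 2)).add (continuous_const.mul (hΩ.pow 2))).intervalIntegrable _ _
  unfold fsCross
  calc a * k / Real.sqrt Ra * |∫ z in (0 : ℝ)..1, vort k v z * θ z|
      ≤ a * k / Real.sqrt Ra * ∫ z in (0 : ℝ)..1, |vort k v z * θ z| := mul_le_mul_of_nonneg_left h1 hc0
    _ = ∫ z in (0 : ℝ)..1, a * k / Real.sqrt Ra * |vort k v z * θ z| := (intervalIntegral.integral_const_mul _ _).symm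
    _ ≤ ∫ z in (0 : ℝ)..1, youngDensity u Ra a k v θ z := by
        refine integral_mono_on zero_le_one hiL hiR fun z _ => ?_
        unfold youngDensity
        exact pointwise_young a k (vort k v z) (θ z) hu hRa

/-- **Young split (L32).** `E_u ≤ fsModeForm` for every `u > 0`, given integrability of the tree integrand (which holds for `Profile` data and
`FreeSlipPair` fields; kept as a hypothesis here to separate concerns). -/
theorem Eu_le_fsModeForm {u Ra a b k : ℝ} {τp v θ : ℝ → ℝ} (hp : FreeSlipPair v θ)
    (hu : 0 < u) (hRa : 0 < Ra) (hk : 0 ≤ k) (ha : 0 ≤ a)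
    (hI : IntervalIntegrable (fsIntegrand Ra a b τp k v θ) volume 0 1) :
    Eu u Ra a b τp k v θ ≤ fsModeForm Ra a b τp k v θ := by
  have hΩ : Continuous (vort k v) := continuous_vort hp.hv k
  have hθ : Continuous θ := hp.hθ.continuous
  have hiR : IntervalIntegrable (youngDensity u Ra a k v θ) volume 0 1 := by
    unfold youngDensity
    exact ((continuous_const.mul (hθ.pow 2)).add (continuous_const.mul (hΩ.pow 2))).intervalIntegrable _ _
  have hY := fsCross_le_integral_young hp hu hRa hk ha
  unfold Eu fsModeForm
  rw [intervalIntegral.integral_sub hI hiR]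
  linarith

end Summit.NavierStokesRegularity.TurbBounds.FSU1.Mode
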